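import Literature.NumberTheory.GaloisRepresentations.ContinuousCorestriction
import Mathlib.GroupTheory.DoubleCoset
import HarnessLib

/-!
# The double-coset (Mackey) formula `res_D ∘ cor_{G/N} = Σ_{D g N} cor_{D/(D ∩ gNg⁻¹)} ∘ g_* ∘ res`
# on continuous `H¹`, for an ARBITRARY open subgroup `N` of finite index and any subgroup `D`

Topic `NumberTheory/GaloisRepresentations` (generic continuous group cohomology; no number theory);
namespace `Literature.NumberTheory.GaloisRepresentations`.  Definitions with bodies (the conjugated
restriction `conjRes`, a `ContinuousCohomology.map`) and theorems; no named fact, no instance.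

Let `G` be a topological group, `X` a topological `G`-module (Mathlib `TopRep`; no discreteness), `N ≤ G`
an OPEN subgroup of finite index (not assumed normal) and `D ≤ G` ANY subgroup.  The tree's
corestriction `cores X N : H¹(N, X) → H¹(G, X)` (`ContinuousCorestriction.lean`, the transfer on
continuous crossed homomorphisms) satisfies the double-coset formula of Neukirch–Schmidt–Wingberg
(1.5.6)–(1.5.7) / Brown III (9.5) (ii):

  `res_D (cor_{G/N} y) = Σ_{q} cor_{D/(D ∩ g_q N g_q⁻¹)} ((g_q)_* res_{N ∩ g_q⁻¹ D g_q} y)`,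

the sum over a system `g_q` of representatives of the double cosets `D \ G / N`, where
`(g)_* res : H¹(N, X) → H¹(D ∩ gNg⁻¹, X)` is the CONJUGATED RESTRICTION `[φ] ↦ [a ↦ g • φ(g⁻¹ a g)]`
(`conjRes`; for `N` normal and `D ∩ gNg⁻¹ = N` it is the tree's action `conjMap X N g`).

* §1 `conjResHom N g A : A →ₜ* N` (`a ↦ g⁻¹ a g`, for a subgroup `A` with `g⁻¹ A g ⊆ N`),
  `conjRes N g A hA X n : Hⁿ(N, X) ⟶ Hⁿ(A, X)` and its value on crossed homomorphisms
  (`conjRes_oneCocycleClass`, `conjRes_pullback_apply`).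
* §2 `bijective_sigma_rep_mul` — the `D`-orbits on `G ⧸ N`: for representatives `g_q` of the double
  cosets (`hcov`, `hdisj`) and `u_{q,δ}` of `D ⧸ (D ∩ g_q N g_q⁻¹)`, the map `(q, δ) ↦ u_{q,δ} g_q N` is a
  bijection `Σ_q D ⧸ (D ∩ g_q N g_q⁻¹) ≃ G ⧸ N`.
* §3 **`resSubgroup_cores_eq_sum_cores_conjRes`** — the formula displayed above (on cocycles it is an
  EQUALITY for the representatives `u_{q,δ} g_q` adapted to the orbits: the Schreier element of
  `d ∈ D` at `u_{q,δ} g_q N` is `g_q⁻¹ (u_{q,dδ}⁻¹ d u_{q,δ}) g_q`); `resSubgroup_cores_eq_zero_of_conjRes`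
  — the VANISHING FORM (if every conjugated restriction of `y` to the subgroups `D ∩ g N g⁻¹` is
  zero then `res_D (cor y) = 0`).
* §4 the same indexed by Mathlib's double-coset quotient `DoubleCoset.Quotient ↑D ↑N` with the
  representatives `Quotient.out` and `D ∩ gNg⁻¹` realised as `{d ∈ D | g⁻¹ d g ∈ N}`
  (`interConj`): `resSubgroup_cores_eq_sum_doubleCoset`, `resSubgroup_cores_eq_zero_of_doubleCoset`.

The special cases already in the tree: `ContinuousCorestrictionResMackey.lean` (one double coset,
`D · N = G`), `ContinuousCorestrictionResNormal.lean` (`D = N` normal), and the Summits tool file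
`…/Rank1Residual/GaloisImage/ContinuousCorestrictionMackey.lean` (`N` NORMAL, any `D`); this file
removes the normality of `N` (needed when `N = Gal(K̄/K')` for a NON-Galois finite extension `K'/K`
and `D` a decomposition or inertia group: the semi-local formula
`loc_v ∘ Cor_{K'/K} = Σ_{w ∣ v} Cor_{K'_w/K_v} ∘ loc_w`).

## References

* J. Neukirch, A. Schmidt, K. Wingberg, *Cohomology of Number Fields*, 2nd ed. (2008), I §5
  Prop. (1.5.6)–(1.5.7) (the double coset formula for `res ∘ cor` on inhomogeneous cochains).
  [NeukirchSchmidtWingberg2008]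
* K. S. Brown, *Cohomology of Groups*, GTM 87 (1982), III (9.5) (ii) (Mackey formula). [Brown1982]
* J.-P. Serre, *Local Fields* (1979), VII §7–§8 (the transfer). [SerreLocalFields1979]
-/

noncomputable section

open CategoryTheory Function Finset

universe u v

namespace Literature.NumberTheory.GaloisRepresentations

open Literature.NumberTheory.EllipticCurves (schreierElt schreierElt_mem schreierElt_coe
  subgroupInclusion subgroupInclusion_apply_coe)

variable {R : Type u} [Ring R] [TopologicalSpace R]
variable {G : Type v} [Group G] [TopologicalSpace G] [IsTopologicalGroup G]

/-! ### §1 The conjugated restriction `Hⁿ(N, X) → Hⁿ(A, X)`, `[φ] ↦ [a ↦ g • φ(g⁻¹ a g)]` -/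

section ConjRes

variable (N : Subgroup G) (g : G) (A : Subgroup G) (hA : ∀ a ∈ A, g⁻¹ * a * g ∈ N)

/-- The continuous homomorphism `A → N`, `a ↦ g⁻¹ a g`, for a subgroup `A` with `g⁻¹ A g ⊆ N`
(typically `A = D ∩ g N g⁻¹`). [cite: NeukirchSchmidtWingberg2008, I §5 (1.5.6)–(1.5.7)] -/
def conjResHom : A →ₜ* N where
  toFun a := ⟨g⁻¹ * (a : G) * g, hA a a.2⟩
  map_one' := Subtype.ext (by simp)
  map_mul' a b := Subtype.ext (by
    simp only [Subgroup.coe_mul]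
    group)
  continuous_toFun :=
    Continuous.subtype_mk ((continuous_const.mul continuous_subtype_val).mul continuous_const) _

omit [TopologicalSpace R] in
/-- Unfolding `conjResHom`: `conjResHom N g A hA a = g⁻¹ a g` in `G` (the conjugation `σ_g` of
Serre, *Local Fields* VII §5). [cite: SerreLocalFields1979, VII §5] -/
@[simp]
theorem conjResHom_apply_coe (a : A) : ((conjResHom N g A hA a : N) : G) = g⁻¹ * (a : G) * g :=
  rfl

variable (X : TopRep.{v} R G)

/-- The module half `v ↦ g • v` of the compatible pair `(a ↦ g⁻¹ a g, v ↦ g • v)` defining the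
conjugated restriction: a morphism `res_{g⁻¹(·)g} (X|N) ⟶ X|A` (Serre, *Local Fields* VII §5, the
pair `(σ_s, s⁻¹·)`). [cite: SerreLocalFields1979, VII §5] -/
def conjResRepHom : TopRep.res (conjResHom N g A hA : A →* N) (subgroupRep X N) ⟶ subgroupRep X A :=
  TopRep.ofHom ⟨X.ρ g, fun a => by
    ext v
    change X.ρ g (X.ρ (g⁻¹ * (a : G) * g) v) = X.ρ (a : G) (X.ρ g v)
    rw [mul_assoc, ρ_mul_apply, ρ_apply_ρ_inv_apply, ρ_mul_apply]⟩

/-- **The conjugated restriction `(g)_* ∘ res : Hⁿ(N, X) → Hⁿ(A, X)`** for a subgroup `A` with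
`g⁻¹ A g ⊆ N`: the map induced on continuous cohomology by the compatible pair
`(A → N, a ↦ g⁻¹ a g; X → X, v ↦ g • v)`; on `1`-cocycles `[φ] ↦ [a ↦ g • φ(g⁻¹ a g)]`
(`conjRes_pullback_apply`).  For `N` normal and `A = N` this is the tree's `conjMap X N g`
(Serre, *Local Fields* VII §5); in the double coset formula it is the summand attached to the
double coset `D g N` with `A = D ∩ g N g⁻¹` (NSW (1.5.6)).
[cite: NeukirchSchmidtWingberg2008, I §5 (1.5.6)–(1.5.7)] -/
def conjRes (n : ℕ) :
    continuousCohomology n (subgroupRep X N) ⟶ continuousCohomology n (subgroupRep X A) :=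
  ContinuousCohomology.map (conjResHom N g A hA) (conjResRepHom N g A hA X) n

/-- `conjRes` on explicit cocycles: `[φ] ↦ [a ↦ g • φ(g⁻¹ a g)]` (Serre, *Local Fields* VII §5).
[cite: SerreLocalFields1979, VII §5] -/
theorem conjRes_oneCocycleClass (φ : contOneCocycles (subgroupRep X N)) :
    conjRes N g A hA X 1 (oneCocycleClass _ φ) =
      oneCocycleClass _ (contOneCocycles.pullback (conjResHom N g A hA) (conjResRepHom N g A hA X) φ) :=
  map_oneCocycleClass _ _ _ φ

/-- Values of the conjugated-restricted cocycle: `((g)_* res φ)(a) = g • φ(g⁻¹ a g)`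
(Serre, *Local Fields* VII §5). [cite: SerreLocalFields1979, VII §5] -/
@[simp]
theorem conjRes_pullback_apply (φ : contOneCocycles (subgroupRep X N)) (a : A) :
    (contOneCocycles.pullback (conjResHom N g A hA) (conjResRepHom N g A hA X) φ).1 a =
      X.ρ g (φ.1 (conjResHom N g A hA a)) :=
  rfl

end ConjRes

/-! ### §2 The `D`-orbits on `G ⧸ N` along a system of double-coset representatives -/

section Orbits

variable (N D : Subgroup G) {Q : Type*} (g : Q → G) (D' : Q → Subgroup G)
  (hD'D : ∀ q, D' q ≤ D) (hD'N : ∀ q, ∀ a ∈ D' q, (g q)⁻¹ * a * g q ∈ N)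
  (hDN : ∀ q, ∀ a ∈ D, (g q)⁻¹ * a * g q ∈ N → a ∈ D' q)
  (hcov : ∀ x : G, ∃ q, ∃ d : D, (g q)⁻¹ * (d : G)⁻¹ * x ∈ N)
  (hdisj : ∀ q q' (d : G), d ∈ D → (g q')⁻¹ * d * g q ∈ N → q = q')

omit [TopologicalSpace G] [IsTopologicalGroup G] in
include hD'N hDN hcov hdisj in
/-- **The `D`-orbits on `G ⧸ N`.**  Let `g_q` (`q ∈ Q`) represent the double cosets `D \ G / N`
(`hcov`: every coset `xN` lies in some orbit `D g_q N / N`; `hdisj`: distinct `q` give distinct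
orbits) and let `D'_q = D ∩ g_q N g_q⁻¹` (any subgroup `D'_q ≤ D` with `g_q⁻¹ D'_q g_q ⊆ N` and
`D ∩ g_q N g_q⁻¹ ⊆ D'_q`), with representatives `u_{q,δ}` of `D ⧸ D'_q`.  Then
`(q, δ) ↦ u_{q,δ} g_q N` is a bijection `Σ_q (D ⧸ D'_q) ≃ G ⧸ N`: the orbit of `g_q N` under `D` is
`D g_q N / N ≅ D ⧸ Stab_D(g_q N) = D ⧸ (D ∩ g_q N g_q⁻¹)`.
[cite: NeukirchSchmidtWingberg2008, I §5 (1.5.6)–(1.5.7)] -/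
theorem bijective_sigma_rep_mul {u : ∀ q, D ⧸ (D' q).subgroupOf D → D}
    (hu : ∀ q δ, (u q δ : D ⧸ (D' q).subgroupOf D) = δ) :
    Function.Bijective fun p : (Σ q, D ⧸ (D' q).subgroupOf D) =>
      ((((u p.1 p.2 : D) : G) * g p.1 : G) : G ⧸ N) := by
  constructor
  · rintro ⟨q₁, δ₁⟩ ⟨q₂, δ₂⟩ h
    have hN : (((u q₁ δ₁ : D) : G) * g q₁)⁻¹ * (((u q₂ δ₂ : D) : G) * g q₂) ∈ N := QuotientGroup.eq.mp h
    -- the two orbits agree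
    have hd : ((u q₁ δ₁ : D) : G)⁻¹ * ((u q₂ δ₂ : D) : G) ∈ D :=
      D.mul_mem (D.inv_mem (u q₁ δ₁).2) (u q₂ δ₂).2
    have hq : q₂ = q₁ := by
      refine hdisj q₂ q₁ _ hd ?_
      have e : (g q₁)⁻¹ * (((u q₁ δ₁ : D) : G)⁻¹ * ((u q₂ δ₂ : D) : G)) * g q₂ =
          (((u q₁ δ₁ : D) : G) * g q₁)⁻¹ * (((u q₂ δ₂ : D) : G) * g q₂) := by group
      rwa [e]
    subst hq
    -- then the two points of the orbit agree
    have hD' : ((u q₂ δ₁)⁻¹ * u q₂ δ₂ : D) ∈ (D' q₂).subgroupOf D := by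
      rw [Subgroup.mem_subgroupOf, Subgroup.coe_mul, Subgroup.coe_inv]
      refine hDN q₂ _ hd ?_
      have e : (g q₂)⁻¹ * (((u q₂ δ₁ : D) : G)⁻¹ * ((u q₂ δ₂ : D) : G)) * g q₂ =
          (((u q₂ δ₁ : D) : G) * g q₂)⁻¹ * (((u q₂ δ₂ : D) : G) * g q₂) := by group
      rwa [e]
    have hδ : δ₁ = δ₂ := by
      rw [← hu q₂ δ₁, ← hu q₂ δ₂]
      exact QuotientGroup.eq.mpr hD'
    subst hδ
    rfl
  · intro y
    induction y using QuotientGroup.induction_on with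
    | H x =>
      obtain ⟨q, d, hqd⟩ := hcov x
      refine ⟨⟨q, ((d : D) : D ⧸ (D' q).subgroupOf D)⟩, ?_⟩
      -- `u δ = d m` with `m ∈ D'_q`
      have hm : ((d⁻¹ * u q (d : D ⧸ (D' q).subgroupOf D) : D) : G) ∈ D' q := by
        have h' : (d⁻¹ * u q (d : D ⧸ (D' q).subgroupOf D) : D) ∈ (D' q).subgroupOf D :=
          QuotientGroup.eq.mp (hu q _).symm
        rwa [Subgroup.mem_subgroupOf] at h'
      have hmN : (g q)⁻¹ * ((d⁻¹ * u q (d : D ⧸ (D' q).subgroupOf D) : D) : G)⁻¹ * g q ∈ N := by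
        have h' := hD'N q _ ((D' q).inv_mem hm)
        exact h'
      change ((((u q (d : D ⧸ (D' q).subgroupOf D) : D) : G) * g q : G) : G ⧸ N) = (x : G ⧸ N)
      rw [QuotientGroup.eq]
      have hprod := N.mul_mem hmN hqd
      have e : (g q)⁻¹ * ((d⁻¹ * u q (d : D ⧸ (D' q).subgroupOf D) : D) : G)⁻¹ * g q *
          ((g q)⁻¹ * (d : G)⁻¹ * x) = (((u q (d : D ⧸ (D' q).subgroupOf D) : D) : G) * g q)⁻¹ * x := by
        rw [Subgroup.coe_mul, Subgroup.coe_inv]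
        group
      rwa [e] at hprod

end Orbits

/-! ### §3 The double-coset formula -/

section Mackey

variable (X : TopRep.{v} R G) (N : Subgroup G) [Fintype (G ⧸ N)] (D : Subgroup G)
  {Q : Type*} [Fintype Q] (g : Q → G) (D' : Q → Subgroup G)
  (hD'D : ∀ q, D' q ≤ D) (hD'N : ∀ q, ∀ a ∈ D' q, (g q)⁻¹ * a * g q ∈ N)
  (hDN : ∀ q, ∀ a ∈ D, (g q)⁻¹ * a * g q ∈ N → a ∈ D' q)
  (hcov : ∀ x : G, ∃ q, ∃ d : D, (g q)⁻¹ * (d : G)⁻¹ * x ∈ N)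
  (hdisj : ∀ q q' (d : G), d ∈ D → (g q')⁻¹ * d * g q ∈ N → q = q')
  [∀ q, Fintype (D ⧸ (D' q).subgroupOf D)]

include hDN hcov hdisj in
/-- **The double-coset (Mackey) formula for corestriction followed by restriction on continuous
`H¹`** (NSW (1.5.6)–(1.5.7); Brown III (9.5) (ii)), for an OPEN subgroup `N` of finite index — not
assumed normal — and ANY subgroup `D`: with `g_q` a system of representatives of `D \ G / N`
(`hcov`, `hdisj`) and `D'_q = D ∩ g_q N g_q⁻¹` (open in `D`),

  `res_D (cor_{G/N} y) = Σ_q cor_{D/D'_q} ((g_q)_* res y)`     on `H¹(N, X)`,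

where `(g_q)_* res : H¹(N, X) → H¹(D'_q, X)` is `conjRes` (`[φ] ↦ [a ↦ g_q • φ(g_q⁻¹ a g_q)]`).  Proof
on cocycles: with the representatives `u_{q,δ} g_q` of `G ⧸ N` adapted to the `D`-orbits
(`bijective_sigma_rep_mul`; the corestriction does not depend on the representatives,
`cores_oneCocycleClass`), the Schreier element of `d ∈ D` at `u_{q,δ} g_q N` is
`g_q⁻¹ (u_{q,dδ}⁻¹ d u_{q,δ}) g_q`, so the `q`-th partial sum of the transfer is the transfer of `D`
along `D'_q` applied to the cocycle `a ↦ g_q • φ(g_q⁻¹ a g_q)`.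
[cite: NeukirchSchmidtWingberg2008, I §5 (1.5.6)–(1.5.7)] -/
theorem resSubgroup_cores_eq_sum_cores_conjRes (hN : IsOpen (N : Set G))
    (hD'o : ∀ q, IsOpen (((D' q).subgroupOf D : Subgroup D) : Set D))
    (y : continuousCohomology 1 (subgroupRep X N)) :
    resSubgroup X D 1 (cores X N hN y) =
      ∑ q, cores (subgroupRep X D) ((D' q).subgroupOf D) (hD'o q)
        (toSubgroupOf X (hD'D q) 1 (conjRes N (g q) (D' q) (hD'N q) X 1 y)) := by
  classical
  obtain ⟨φ, rfl⟩ := oneCocycleClass_surjective _ y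
  set u : ∀ q, D ⧸ (D' q).subgroupOf D → D := fun _ => Quotient.out with hu_def
  have hu : ∀ q δ, (u q δ : D ⧸ (D' q).subgroupOf D) = δ := fun _ => QuotientGroup.out_eq'
  set e : (Σ q, D ⧸ (D' q).subgroupOf D) ≃ G ⧸ N :=
    Equiv.ofBijective _ (bijective_sigma_rep_mul N D g D' hD'N hDN hcov hdisj hu) with he_def
  have he : ∀ p : Σ q, D ⧸ (D' q).subgroupOf D,
      e p = ((((u p.1 p.2 : D) : G) * g p.1 : G) : G ⧸ N) := fun p => rfl
  -- representatives of `G ⧸ N` adapted to the `D`-orbits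
  set F : (Σ q, D ⧸ (D' q).subgroupOf D) → G := fun p => ((u p.1 p.2 : D) : G) * g p.1 with hF_def
  set s : G ⧸ N → G := fun y => F (e.symm y) with hs_def
  have hse : ∀ p : Σ q, D ⧸ (D' q).subgroupOf D, s (e p) = ((u p.1 p.2 : D) : G) * g p.1 :=
    fun p => congrArg F (e.symm_apply_apply p)
  have hs : ∀ y, (s y : G ⧸ N) = y := fun y => by
    obtain ⟨p, rfl⟩ := e.surjective y
    rw [hse, he]
  -- `d • e (q, δ) = e (q, d • δ)` for `d ∈ D`
  have hsmul : ∀ (d : D) (q : Q) (δ : D ⧸ (D' q).subgroupOf D),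
      (d : G) • e ⟨q, δ⟩ = e ⟨q, d • δ⟩ := fun d q δ => by
    rw [he, he, MulAction.Quotient.smul_coe, QuotientGroup.eq, smul_eq_mul]
    have hmem := (schreierElt ((D' q).subgroupOf D) (hu q) d δ).2
    rw [Subgroup.mem_subgroupOf, schreierElt_coe, Subgroup.coe_mul, Subgroup.coe_mul,
      Subgroup.coe_inv] at hmem
    have hN' := N.inv_mem (hD'N q _ hmem)
    have e' : ((g q)⁻¹ * (((u q (d • δ) : D) : G)⁻¹ * (d : G) * ((u q δ : D) : G)) * g q)⁻¹ =
        ((d : G) * (((u q δ : D) : G) * g q))⁻¹ * (((u q (d • δ) : D) : G) * g q) := by group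
    rwa [e'] at hN'
  -- both sides as classes of explicit cocycles
  rw [cores_oneCocycleClass X N hN hs, resSubgroup_oneCocycleClass]
  simp only [conjRes_oneCocycleClass, toSubgroupOf, map_oneCocycleClass,
    cores_oneCocycleClass _ _ (hD'o _) (hu _)]
  simp only [← oneCocycleClassₗ_apply]
  rw [← map_sum]
  simp only [oneCocycleClassₗ_apply]
  refine congrArg _ (Subtype.ext (ContinuousMap.ext fun d => ?_))
  rw [resSubgroup_pullback_apply, transferCocycle_apply, transferFun_apply, ← e.sum_comp,
    Fintype.sum_sigma, sum_apply_val']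
  refine Finset.sum_congr rfl fun q _ => ?_
  rw [transferCocycle_apply, transferFun_apply]
  refine Finset.sum_congr rfl fun δ _ => ?_
  rw [hsmul, hse, ρ_mul_apply, subgroupRep_ρ_apply, contOneCocycles.pullback_apply,
    conjRes_pullback_apply]
  change X.ρ _ (X.ρ _ (φ.1 _)) = X.ρ _ (X.ρ _ (φ.1 _))
  congr 3
  apply Subtype.ext
  rw [schreierElt_coe, hsmul, hse, hse, conjResHom_apply_coe, subgroupOfHom_apply_coe,
    schreierElt_coe, Subgroup.coe_mul, Subgroup.coe_mul, Subgroup.coe_inv]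
  dsimp only
  group

include hD'D hDN hcov hdisj in
/-- **Vanishing form of the double-coset formula**: if the conjugated restriction of `y` to every
`D ∩ g_q N g_q⁻¹` vanishes, then `res_D (cor_{G/N} y) = 0`.  (For `G = Γ_K`, `N = Γ_{K'}` and `D`
an inertia group: a class of `H¹(K', X)` unramified at every place above `v` corestricts to a class
unramified at `v`.) [cite: NeukirchSchmidtWingberg2008, I §5 (1.5.6)–(1.5.7)] -/
theorem resSubgroup_cores_eq_zero_of_conjRes (hN : IsOpen (N : Set G))
    (hD'o : ∀ q, IsOpen (((D' q).subgroupOf D : Subgroup D) : Set D))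
    (y : continuousCohomology 1 (subgroupRep X N))
    (hy : ∀ q, conjRes N (g q) (D' q) (hD'N q) X 1 y = 0) :
    resSubgroup X D 1 (cores X N hN y) = 0 := by
  rw [resSubgroup_cores_eq_sum_cores_conjRes X N D g D' hD'D hD'N hDN hcov hdisj hN hD'o y]
  refine Finset.sum_eq_zero fun q _ => ?_
  rw [hy q, map_zero, map_zero]

end Mackey

/-! ### §4 The formula over Mathlib's double-coset quotient `D \ G / N` -/

section DoubleCosetQuotient

variable (N D : Subgroup G)

/-- The subgroup `D ∩ g N g⁻¹ = {d ∈ D | g⁻¹ d g ∈ N}` (the stabiliser in `D` of the coset `g N`).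
[cite: NeukirchSchmidtWingberg2008, I §5 (1.5.6)–(1.5.7)] -/
def interConj (g : G) : Subgroup G where
  carrier := {d | d ∈ D ∧ g⁻¹ * d * g ∈ N}
  one_mem' := ⟨D.one_mem, by simp⟩
  mul_mem' := fun {a b} ha hb => ⟨D.mul_mem ha.1 hb.1, by
    have h := N.mul_mem ha.2 hb.2
    have e : g⁻¹ * a * g * (g⁻¹ * b * g) = g⁻¹ * (a * b) * g := by group
    rwa [e] at h⟩
  inv_mem' := fun {a} ha => ⟨D.inv_mem ha.1, by
    have h := N.inv_mem ha.2
    have e : (g⁻¹ * a * g)⁻¹ = g⁻¹ * a⁻¹ * g := by group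
    rwa [e] at h⟩

omit [TopologicalSpace G] [IsTopologicalGroup G] in
/-- Membership in `interConj N D g = D ∩ g N g⁻¹`. [cite: NeukirchSchmidtWingberg2008, I §5 (1.5.6)–(1.5.7)] -/
@[simp]
theorem mem_interConj (g a : G) : a ∈ interConj N D g ↔ a ∈ D ∧ g⁻¹ * a * g ∈ N :=
  Iff.rfl

omit [TopologicalSpace G] [IsTopologicalGroup G] in
/-- `interConj N D g = D ∩ g N g⁻¹ ≤ D`. [cite: NeukirchSchmidtWingberg2008, I §5 (1.5.6)–(1.5.7)] -/
theorem interConj_le (g : G) : interConj N D g ≤ D := fun _ ha => ha.1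

omit [IsTopologicalGroup G] in
/-- `D ∩ g N g⁻¹` is open in `D` when `N` is open in `G` (so that `cor_{D/(D ∩ gNg⁻¹)}` on continuous
`H¹` is defined). [cite: NeukirchSchmidtWingberg2008, I §5 (1.5.6)–(1.5.7)] -/
theorem isOpen_interConj_subgroupOf [ContinuousMul G] (hN : IsOpen (N : Set G)) (g : G) :
    IsOpen (((interConj N D g).subgroupOf D : Subgroup D) : Set D) := by
  have hc : Continuous fun d : D => g⁻¹ * (d : G) * g :=
    (continuous_const.mul continuous_subtype_val).mul continuous_const
  have hset : (((interConj N D g).subgroupOf D : Subgroup D) : Set D) =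
      (fun d : D => g⁻¹ * (d : G) * g) ⁻¹' (N : Set G) := by
    ext d
    simp only [SetLike.mem_coe, Subgroup.mem_subgroupOf, mem_interConj, Set.mem_preimage]
    exact ⟨fun h => h.2, fun h => ⟨d.2, h⟩⟩
  rw [hset]
  exact hN.preimage hc

omit [TopologicalSpace G] [IsTopologicalGroup G] in
/-- The representatives `Quotient.out` of `DoubleCoset.Quotient ↑D ↑N` cover `G ⧸ N` by `D`-orbits:
for `q = D x N` one has `q.out = h x k` (`h ∈ D`, `k ∈ N`), so `q.out⁻¹ (h⁻¹)⁻¹ x = k⁻¹ ∈ N` (the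
decomposition `G = ⨆ D g_q N` of NSW (1.5.6)). [cite: NeukirchSchmidtWingberg2008, I §5 (1.5.6)–(1.5.7)] -/
theorem exists_out_doubleCoset_rel (x : G) :
    ∃ q : DoubleCoset.Quotient (D : Set G) N, ∃ d : D, (q.out)⁻¹ * (d : G)⁻¹ * x ∈ N := by
  obtain ⟨h, k, hh, hk, hout⟩ := DoubleCoset.mk_out_eq_mul D N x
  refine ⟨DoubleCoset.mk D N x, ⟨h⁻¹, D.inv_mem hh⟩, ?_⟩
  rw [hout]
  have e : (h * x * k)⁻¹ * (h⁻¹ : G)⁻¹ * x = k⁻¹ := by group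
  rw [e]
  exact N.inv_mem hk

omit [TopologicalSpace G] [IsTopologicalGroup G] in
/-- Distinct double cosets have disjoint `D`-orbits: if `q'.out⁻¹ d q.out ∈ N` with `d ∈ D` then
`q = q'` (NSW (1.5.6), disjointness of the decomposition `G = ⨆ D g_q N`).
[cite: NeukirchSchmidtWingberg2008, I §5 (1.5.6)–(1.5.7)] -/
theorem doubleCoset_eq_of_rel (q q' : DoubleCoset.Quotient (D : Set G) N) (d : G) (hd : d ∈ D)
    (h : (q'.out)⁻¹ * d * q.out ∈ N) : q = q' := by
  rw [← DoubleCoset.out_eq' D N q, ← DoubleCoset.out_eq' D N q', eq_comm, DoubleCoset.eq]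
  refine ⟨d⁻¹, D.inv_mem hd, (q'.out)⁻¹ * d * q.out, h, ?_⟩
  group

variable (X : TopRep.{v} R G) [Fintype (G ⧸ N)] [Fintype (DoubleCoset.Quotient (D : Set G) N)]
  [∀ q : DoubleCoset.Quotient (D : Set G) N, Fintype (D ⧸ (interConj N D q.out).subgroupOf D)]

/-- **The double-coset formula over `D \ G / N`** (NSW (1.5.6)–(1.5.7)): for an open subgroup `N` of
finite index, any subgroup `D`, and the representatives `g_q = q.out` of Mathlib's
`DoubleCoset.Quotient ↑D ↑N`,
`res_D (cor_{G/N} y) = Σ_{q ∈ D\G/N} cor_{D/(D ∩ g_q N g_q⁻¹)} ((g_q)_* res y)`.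
[cite: NeukirchSchmidtWingberg2008, I §5 (1.5.6)–(1.5.7)] -/
theorem resSubgroup_cores_eq_sum_doubleCoset (hN : IsOpen (N : Set G))
    (y : continuousCohomology 1 (subgroupRep X N)) :
    resSubgroup X D 1 (cores X N hN y) =
      ∑ q : DoubleCoset.Quotient (D : Set G) N,
        cores (subgroupRep X D) ((interConj N D q.out).subgroupOf D)
          (isOpen_interConj_subgroupOf N D hN q.out)
          (toSubgroupOf X (interConj_le N D q.out) 1
            (conjRes N q.out (interConj N D q.out) (fun _ ha => ha.2) X 1 y)) :=
  resSubgroup_cores_eq_sum_cores_conjRes X N D (fun q : DoubleCoset.Quotient (D : Set G) N => q.out)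
    (fun q => interConj N D q.out) (fun q => interConj_le N D q.out) (fun _ _ ha => ha.2)
    (fun _ _ ha hN' => ⟨ha, hN'⟩) (exists_out_doubleCoset_rel N D) (doubleCoset_eq_of_rel N D) hN
    (fun q => isOpen_interConj_subgroupOf N D hN q.out) y

/-- **Vanishing form over `D \ G / N`**: if `(g)_* res_{N ∩ g⁻¹ D g} y = 0` in `H¹(D ∩ g N g⁻¹, X)` for the
representative `g` of every double coset, then `res_D (cor_{G/N} y) = 0`.
[cite: NeukirchSchmidtWingberg2008, I §5 (1.5.6)–(1.5.7)] -/
theorem resSubgroup_cores_eq_zero_of_doubleCoset (hN : IsOpen (N : Set G))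
    (y : continuousCohomology 1 (subgroupRep X N))
    (hy : ∀ q : DoubleCoset.Quotient (D : Set G) N,
      conjRes N q.out (interConj N D q.out) (fun _ ha => ha.2) X 1 y = 0) :
    resSubgroup X D 1 (cores X N hN y) = 0 := by
  rw [resSubgroup_cores_eq_sum_doubleCoset N D X hN y]
  refine Finset.sum_eq_zero fun q _ => ?_
  rw [hy q, map_zero, map_zero]

end DoubleCosetQuotient

end Literature.NumberTheory.GaloisRepresentations

end
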